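import Mathlib
import Summits.Ventures.PercRepro.TriangleCapRowTEvery
import Summits.Ventures.PercRepro.TriangleCapRowTTable

/-!
# PercRepro — THE STABILITY TABLE OF THE `K₄⁻`-FREE CHERRY TABLE ON EVERY CELL OF EVERY ROW `a ≥ 5`, WITH NO BOUND
ON `a`: the non-`a`-bipartite second-best value on `(k, a, r)`, `2a + r ≤ k`, `2a + 2 ≤ k`, is EXACTLY
`closed − stabGapFull k a r`, and the second-best value of the cherry table is `closed − 2 (r − 2)` on every cell
`r ≥ 3` (p3, gen 49; part 204d)

`stab_table_every` = part 204b (`r ≤ a − 3`, the family `B2`) + the rows `r = a − 2`, `a − 1` re-derived for every `a`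
(part 204c, the families `T` and `B2`) + the rows `r ≥ a` for every `a` (part 204c: `rowJ_second_order_every`,
`rowTreg_second_order_every`; the `(r − a + 1)`-broom and the one-triangle family). The bound `a ≤ 18` of every
earlier table statement (parts 200l, 201d, 202i, 203g) entered through the corner `k = 2a + r` of the `B2` regime
alone, closed in part 204a by the near-cap vertex. Axioms: standard.
-/

namespace PercRepro

namespace TriangleCap

namespace C047

open Finset

/-- **THE NON-BIPARTITE SECOND-BEST VALUE ON THE CELL `(k, a, a − 2)` FOR EVERY `a ≥ 5`, `3a − 2 ≤ k`:** EXACTLY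
`m k − (a − 2)(k − a + 1) − 2 (k − 2a − 1)`, attained by the one-triangle family. -/
theorem rowT_nonbip_second_best_every (k a : ℕ) (ha5 : 5 ≤ a) (hk : 3 * a ≤ k + 2) :
    (∀ (D : SimpleGraph (Fin k)) [DecidableRel D.Adj], K4mFree D → D.edgeFinset.card + (a - 2) = a * (k - a) →
        (¬ ∃ A : Finset (Fin k), A.card = a ∧ BipSub D A) →
        ∑ v, deg D v * deg D v + (a - 2) * (k - 1 - (a - 2)) + 2 * (k - 2 * a - 1) ≤ D.edgeFinset.card * k) ∧
      ∃ (D : SimpleGraph (Fin k)) (_ : DecidableRel D.Adj), K4mFree D ∧ D.edgeFinset.card + (a - 2) = a * (k - a) ∧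
        (¬ ∃ A : Finset (Fin k), A.card = a ∧ BipSub D A) ∧
        ∑ v, deg D v * deg D v + (a - 2) * (k - 1 - (a - 2)) + 2 * (k - 2 * a - 1) = D.edgeFinset.card * k := by
  have hcard : Fintype.card (Fin k) = k := Fintype.card_fin k
  refine ⟨?_, ?_⟩
  · intro D _ hK hm hnb
    rcases rowT_second_order_gen_every D hK a (a - 2) ha5 (by omega) (by rw [hcard]; omega) (by rw [hcard]; exact hm)
      with h | h
    · exact absurd h hnb
    · rw [hcard] at h
      exact h
  · obtain ⟨n, rfl⟩ : ∃ n, k = n + 1 := ⟨k - 1, by omega⟩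
    obtain ⟨hK, hE, hS, hnb⟩ := tFamilyGen_value n a 0 (by omega) (by omega) (by omega)
    refine ⟨tFamilyGen n a 0 (by omega), inferInstance, hK, ?_, fun ⟨A, _, hB⟩ => hnb A hB, ?_⟩
    · have e : 0 + a - 2 = a - 2 := by omega
      rw [e] at hE
      exact hE
    · have e : 0 + a - 2 = a - 2 := by omega
      rw [e] at hS
      simp only [mul_zero, zero_mul, add_zero] at hS
      have e2 : 2 * (n - 2 * a) = 2 * (n + 1 - 2 * a - 1) := by omega
      rw [e2] at hS
      exact hS

/-- **THE NON-BIPARTITE SECOND-BEST VALUE ON THE CELL `(k, a, a − 1)` FOR EVERY `a ≥ 5`, `3a − 1 ≤ k`:** EXACTLY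
`m k − (a − 1)(k − a) − 2 (k − 2a − 1)`, attained by the family `B2`. -/
theorem rowB_nonbip_second_best_every (k a : ℕ) (ha5 : 5 ≤ a) (hk : 3 * a ≤ k + 1) :
    (∀ (D : SimpleGraph (Fin k)) [DecidableRel D.Adj], K4mFree D → D.edgeFinset.card + (a - 1) = a * (k - a) →
        (¬ ∃ A : Finset (Fin k), A.card = a ∧ BipSub D A) →
        ∑ v, deg D v * deg D v + (a - 1) * (k - 1 - (a - 1)) + 2 * (k - 2 * a - 1) ≤ D.edgeFinset.card * k) ∧
      ∃ (D : SimpleGraph (Fin k)) (_ : DecidableRel D.Adj), K4mFree D ∧ D.edgeFinset.card + (a - 1) = a * (k - a) ∧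
        (¬ ∃ A : Finset (Fin k), A.card = a ∧ BipSub D A) ∧
        ∑ v, deg D v * deg D v + (a - 1) * (k - 1 - (a - 1)) + 2 * (k - 2 * a - 1) = D.edgeFinset.card * k := by
  have hcard : Fintype.card (Fin k) = k := Fintype.card_fin k
  refine ⟨?_, ?_⟩
  · intro D _ hK hm hnb
    rcases rowB_second_order_all_every D hK a (a - 1) ha5 (by omega) (by rw [hcard]; omega) (by rw [hcard]; exact hm)
      with h | h
    · exact absurd h hnb
    · rw [hcard] at h
      exact h
  · obtain ⟨hK, hE, hnb, hS⟩ := rowB_witness' k a ha5 hk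
    exact ⟨_, inferInstance, hK, hE, hnb, hS⟩

/-- **EVERY ROW `r = a + j` FOR EVERY `a ≥ 5`, EVERY `j`, `3a + j ≤ k`:** `K₄⁻`-free, `m + (a + j) = a (k − a)` ⇒
`a`-bipartite or `Σ_v d(v)² + (a + j)(k − 1 − (a + j)) + min (2 (k − a − 3) + 2j (a − 2)) (2k − 14 + 2j (a − 3)) ≤ m k`. -/
theorem rowAll_second_order_every {V : Type*} [Fintype V] [DecidableEq V] (D : SimpleGraph V) [DecidableRel D.Adj]
    (hK : K4mFree D) (a j : ℕ) (ha5 : 5 ≤ a) (hk : 3 * a + j ≤ Fintype.card V)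
    (hm : D.edgeFinset.card + (a + j) = a * (Fintype.card V - a)) :
    (∃ A : Finset V, A.card = a ∧ BipSub D A) ∨
      ∑ v, deg D v * deg D v + (a + j) * (Fintype.card V - 1 - (a + j)) +
          min (2 * (Fintype.card V - a - 3) + 2 * j * (a - 2)) (2 * Fintype.card V - 14 + 2 * j * (a - 3)) ≤
        D.edgeFinset.card * Fintype.card V := by
  rcases Nat.lt_or_ge (j + 4) a with hja | hja
  · rcases rowJ_second_order_every D hK a j (by omega) hk hm with h | h
    · exact Or.inl h
    · right
      have hle := broomGap_le_tGap (Fintype.card V) a j (by omega) (by omega) (by omega)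
      rw [min_eq_left hle]
      exact h
  · rcases rowTreg_second_order_every D hK a j ha5 hja hk hm with h | h
    · exact Or.inl h
    · right
      have hle := tGap_le_broomGap (Fintype.card V) a j (by omega) hja (by omega) (by omega)
      rw [min_eq_right hle]
      exact h

/-- **THE NON-BIPARTITE SECOND-BEST VALUE ON EVERY CELL `(k, a, a + j)` FOR EVERY `a ≥ 5`, EVERY `j`, `3a + j ≤ k`:**
EXACTLY `closed − min (2 (k − a − 3) + 2j (a − 2)) (2k − 14 + 2j (a − 3))`, attained. -/
theorem rowAll_nonbip_second_best_every (k a j : ℕ) (ha5 : 5 ≤ a) (hk : 3 * a + j ≤ k) :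
    (∀ (D : SimpleGraph (Fin k)) [DecidableRel D.Adj], K4mFree D → D.edgeFinset.card + (a + j) = a * (k - a) →
        (¬ ∃ A : Finset (Fin k), A.card = a ∧ BipSub D A) →
        ∑ v, deg D v * deg D v + (a + j) * (k - 1 - (a + j)) +
            min (2 * (k - a - 3) + 2 * j * (a - 2)) (2 * k - 14 + 2 * j * (a - 3)) ≤ D.edgeFinset.card * k) ∧
      ∃ (D : SimpleGraph (Fin k)) (_ : DecidableRel D.Adj), K4mFree D ∧ D.edgeFinset.card + (a + j) = a * (k - a) ∧
        (¬ ∃ A : Finset (Fin k), A.card = a ∧ BipSub D A) ∧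
        ∑ v, deg D v * deg D v + (a + j) * (k - 1 - (a + j)) +
            min (2 * (k - a - 3) + 2 * j * (a - 2)) (2 * k - 14 + 2 * j * (a - 3)) = D.edgeFinset.card * k := by
  have hcard : Fintype.card (Fin k) = k := Fintype.card_fin k
  refine ⟨?_, ?_⟩
  · intro D _ hK hm hnb
    rcases rowAll_second_order_every D hK a j ha5 (by rw [hcard]; exact hk) (by rw [hcard]; exact hm) with h | h
    · exact absurd h hnb
    · rw [hcard] at h
      exact h
  · rcases Nat.lt_or_ge (j + 4) a with hja | hja
    · have hle := broomGap_le_tGap k a j (by omega) (by omega) (by omega)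
      rw [min_eq_left hle]
      obtain ⟨hK, hE, hnb, hS⟩ := multiBroom_value k a j (by omega) (by omega) (by omega)
      exact ⟨_, inferInstance, hK, hE, hnb, hS⟩
    · have hle := tGap_le_broomGap k a j (by omega) hja (by omega) (by omega)
      rw [min_eq_right hle]
      obtain ⟨n, rfl⟩ : ∃ n, k = n + 1 := ⟨k - 1, by omega⟩
      obtain ⟨hK, hE, hS, hnb⟩ := tFamilyGen_value n a (j + 2) (by omega) (by omega) (by omega)
      refine ⟨tFamilyGen n a (j + 2) (by omega), inferInstance, hK, ?_, fun ⟨A, _, hB⟩ => hnb A hB, ?_⟩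
      · have e : j + 2 + a - 2 = a + j := by omega
        rw [e] at hE
        exact hE
      · have e : j + 2 + a - 2 = a + j := by omega
        rw [e] at hS
        have e2 : 2 * (n - 2 * a) + 2 * (j + 2) * (a - 3) = 2 * (n + 1) - 14 + 2 * j * (a - 3) := by
          have h1 : 2 * a ≤ n := by omega
          have h2 : 3 ≤ a := by omega
          have h3 : 14 ≤ 2 * (n + 1) := by omega
          zify [h1, h2, h3]
          ring
        rw [add_assoc, e2] at hS
        exact hS

/-- **THE WHOLE STABILITY TABLE OF THE `K₄⁻`-FREE CHERRY TABLE, EVERY ROW `a ≥ 5`, EVERY `r`, `2a + r ≤ k`,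
`2a + 2 ≤ k`:** every non-`a`-bipartite `K₄⁻`-free graph on `Fin k` with `a (k − a) − r` edges has
`Σ_v d(v)² + r (k − 1 − r) + stabGapFull k a r ≤ m k`, and the value is attained by a non-`a`-bipartite graph —
no bound on `a`. -/
theorem stab_table_every (k a r : ℕ) (ha5 : 5 ≤ a) (hk : 2 * a + r ≤ k) (hk2 : 2 * a + 2 ≤ k) :
    (∀ (D : SimpleGraph (Fin k)) [DecidableRel D.Adj], K4mFree D → D.edgeFinset.card + r = a * (k - a) →
        (¬ ∃ A : Finset (Fin k), A.card = a ∧ BipSub D A) →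
        ∑ v, deg D v * deg D v + r * (k - 1 - r) + stabGapFull k a r ≤ D.edgeFinset.card * k) ∧
      ∃ (D : SimpleGraph (Fin k)) (_ : DecidableRel D.Adj), K4mFree D ∧ D.edgeFinset.card + r = a * (k - a) ∧
        (¬ ∃ A : Finset (Fin k), A.card = a ∧ BipSub D A) ∧
        ∑ v, deg D v * deg D v + r * (k - 1 - r) + stabGapFull k a r = D.edgeFinset.card * k := by
  by_cases h3 : r + 3 ≤ a
  · have hgap : stabGapFull k a r = 2 * (k - 2 * a - 1) * (a - r) := by simp [stabGapFull, h3]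
    rw [hgap]
    exact below_nonbip_second_best_every k a r (by omega) h3 hk2 hk
  rcases Nat.lt_or_ge r a with hr | hr
  · have hgap : stabGapFull k a r = 2 * (k - 2 * a - 1) := by
      unfold stabGapFull
      have h1 : r + 1 ≤ a := by omega
      simp [h3, h1]
    rw [hgap]
    rcases Nat.lt_or_ge (r + 1) a with hr2 | hr1
    · have hr' : r = a - 2 := by omega
      subst hr'
      exact rowT_nonbip_second_best_every k a ha5 (by omega)
    · have hr' : r = a - 1 := by omega
      subst hr'
      exact rowB_nonbip_second_best_every k a ha5 (by omega)
  · have hgap : stabGapFull k a r =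
        min (2 * (k - a - 3) + 2 * (r - a) * (a - 2)) (2 * k - 14 + 2 * (r - a) * (a - 3)) := by
      unfold stabGapFull
      have h1 : ¬ r + 1 ≤ a := by omega
      simp [h3, h1]
    rw [hgap]
    obtain ⟨j, rfl⟩ : ∃ j, r = a + j := ⟨r - a, by omega⟩
    have e : a + j - a = j := by omega
    rw [e]
    exact rowAll_nonbip_second_best_every k a j ha5 (by omega)

/-- **THE SECOND-BEST VALUE OF THE CHERRY TABLE ON EVERY CELL `r ≥ 3` OF EVERY ROW `a ≥ 5`**, `2a + r ≤ k`:
`closed − 2 (r − 2)` (the brooms of the `a`-side) — no bound on `a`. -/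
theorem cherry_second_best_every (k a r : ℕ) (ha5 : 5 ≤ a) (hr3 : 3 ≤ r) (hk : 2 * a + r ≤ k) :
    (∀ (D : SimpleGraph (Fin k)) [DecidableRel D.Adj], K4mFree D → D.edgeFinset.card + r = a * (k - a) →
        ∑ v, deg D v * deg D v + r * (k - 1 - r) ≠ D.edgeFinset.card * k →
        ∑ v, deg D v * deg D v + r * (k - 1 - r) + 2 * (r - 2) ≤ D.edgeFinset.card * k) ∧
      ∃ (D : SimpleGraph (Fin k)) (_ : DecidableRel D.Adj), K4mFree D ∧ D.edgeFinset.card + r = a * (k - a) ∧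
        ∑ v, deg D v * deg D v + r * (k - 1 - r) + 2 * (r - 2) = D.edgeFinset.card * k := by
  have hcard : Fintype.card (Fin k) = k := Fintype.card_fin k
  refine ⟨?_, ?_⟩
  · intro D _ hK hm hne
    by_cases hnb : ∃ A : Finset (Fin k), A.card = a ∧ BipSub D A
    · obtain ⟨A, hAcard, hB⟩ := hnb
      by_cases hstar : ∃ v, MissingStar D A v
      · obtain ⟨v, hv⟩ := hstar
        have h := closed_form_eq_of_missingStar D A hB hv a r hAcard (by rw [hcard]; exact hm)
          (by rw [hcard]; omega)
        rw [hcard] at h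
        exact absurd h hne
      · have h := closed_form_stability_bipSub D A hB a r hAcard (by rw [hcard]; exact hm) (by rw [hcard]; omega)
          (by omega) hstar
        rw [hcard] at h
        exact h
    · have h := (stab_table_every k a r ha5 hk (by omega)).1 D hK hm hnb
      have hge : 2 * (r - 2) ≤ stabGapFull k a r := by
        unfold stabGapFull
        by_cases h3 : r + 3 ≤ a
        · rw [if_pos h3]
          have h1 : r - 1 ≤ k - 2 * a - 1 := by omega
          have h3' : 1 ≤ a - r := by omega
          calc 2 * (r - 2) = 2 * (r - 2) * 1 := by ring
            _ ≤ 2 * (r - 1) * (a - r) := Nat.mul_le_mul (by omega) h3'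
            _ ≤ 2 * (k - 2 * a - 1) * (a - r) := Nat.mul_le_mul_right _ (by omega)
        · rw [if_neg h3]
          by_cases h1 : r + 1 ≤ a
          · rw [if_pos h1]
            omega
          · rw [if_neg h1]
            obtain ⟨j, rfl⟩ : ∃ j, r = a + j := ⟨r - a, by omega⟩
            have e : a + j - a = j := by omega
            rw [e]
            exact two_sub_le_min_gap k a j ha5 (by omega)
      omega
  · obtain ⟨D, inst, A, hK, hAcard, hB, hns, hE, hS⟩ := broom_value k a r (by omega) (by omega) (by omega)
    have hr' : r ≤ a * (k - a) := by
      have h2 : 1 * (k - a) ≤ a * (k - a) := Nat.mul_le_mul_right _ (by omega)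
      omega
    have hE' : D.edgeFinset.card + r = a * (k - a) := by rw [hE]; omega
    refine ⟨D, inst, hK, hE', ?_⟩
    rw [hE]
    exact hS

end C047

end TriangleCap

end PercRepro
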